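import Literature.Probability.Percolation.TwoSetExchange
import Summits.CriticalPhenomena.PercolationContinuityZ3.Theorems.PercNearOneGluingNoHeavyLowerTailFourPointAtoms
import HarnessLib

/-!
# Four-point cells under relabelling of the marked points, and three exchange rows (A′, D′, D″)

Support file for crux `stmt-CriticalPhenomena-4575` (master-family programme, row `Q44` = Conjecture W), seat `prim-l12-p6` gen 25; memo
`run/shared/lean/prim/prim-l12/FROM-prim-l12-p6-g25-W-PENCIL.md` §4b.  Consumer: `…Q44RowUpToTopGood` (Conjecture W up to one top good).
Cells `cell w a b c y i` of `FourPointAtoms.pat4` (`0 a|b|c|y, 1 a|b|cy, 2 a|by|c, 3 a|bc|y, 4 ay|b|c, 5 ac|b|y, 6 ab|c|y, 7 a|bcy, 8 ay|bc,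
9 ac|by, 10 acy|b, 11 ab|cy, 12 aby|c, 13 abc|y, 14 abcy`).
* `Q44TopGood.cell_relabel_acby/bacy/caby/ycab/bayc/ycba` — the cells of a relabelled quadruple (e.g. `cell w a c b y i`) as explicit
  indicator sums of the cells of `(a,b,c,y)` (pattern bookkeeping via `hasPattern_atom_perm`; after `prim-bnk-1` gen 33's `cell_relabel_acby`),
  so that kernel theorems stated for `(a,b,c,y)` (`TwoCopyMono.q44b_pack_nine`, `SingleSourceLaw.pack_singleSource`, …) can be used for any
  labelling inside one cell calculus.
* Three single-product exchange rows, each ONE instance of the two-set exchange `setTwoClusterExchange` (van den Berg–Häggström–Kahn 2006,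
  Thm 2.1 at `q = 1`) plus the events ↦ cells dictionary:
  `exch_c0c9_le_c2c5 : c₀c₉ ≤ c₂c₅` (type A for the matching `ac|by`: `S={a,c}`, `T={b,y}`),
  `exch_c1c8_le_c4c7 : c₁c₈ ≤ c₄c₇` (type D′: `S={a}`, `T={b,c}`), `exch_c6c8_le_c3c12 : c₆c₈ ≤ c₃c₁₂` (type D″: `S={c}`, `T={a,y}`).
No named facts, no sorries, no definitions; standard axioms.
-/

noncomputable section

namespace Summit.CriticalPhenomena.PercolationContinuityZ3.Theorems

namespace Q44TopGood

open MeasureTheory Set Literature.Probability.Percolation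
open Literature.Probability.LatticeModels (prodBernoulli)
open FourPointAtoms
open Summit.CriticalPhenomena.PercolationContinuityZ3.Cruxes.AdditiveGluing.TieLine.ConnAtoms
open scoped Classical

variable {n : ℕ}

/-! ## Relabelled quadruples -/

/-- The atoms of a relabelled quadruple `q' = quad ∘ σ` as pattern events of `(a,b,c,y)`. [folklore] -/
theorem hasPattern_atom_perm (σ : Fin 4 → Fin 4) (a b c y : Fin n) {q' : Fin 4 → Fin n}
    (hq : ∀ j, q' j = quad a b c y (σ j)) (π₀ : Fin 4 → Fin 4) :
    HasPattern (quad a b c y) (atom q' π₀) (fun π => ∀ j k : Fin 4, π (σ j) = π (σ k) ↔ π₀ j = π₀ k) := by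
  intro π _ ω hω; simp only [mem_atom]; constructor
  · intro h j k; rw [← hω, ← hq, ← hq]; exact h j k
  · intro h j k; rw [hq, hq, hω]; exact h j k

/-- Cells of the relabelled quadruple `(a c b y)` in the cells of `(a,b,c,y)`. [folklore] -/
theorem cell_relabel_acby (w : Sym2 (Fin n) → unitInterval) (a b c y : Fin n) (i : Fin 15) :
    cell w a c b y i =
      (if (∀ j k : Fin 4, pat4 0 ((![0, 2, 1, 3] : Fin 4 → Fin 4) j) = pat4 0 ((![0, 2, 1, 3] : Fin 4 → Fin 4) k) ↔ pat4 i j = pat4 i k) then cell w a b c y 0 else 0) +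
      (if (∀ j k : Fin 4, pat4 1 ((![0, 2, 1, 3] : Fin 4 → Fin 4) j) = pat4 1 ((![0, 2, 1, 3] : Fin 4 → Fin 4) k) ↔ pat4 i j = pat4 i k) then cell w a b c y 1 else 0) +
      (if (∀ j k : Fin 4, pat4 2 ((![0, 2, 1, 3] : Fin 4 → Fin 4) j) = pat4 2 ((![0, 2, 1, 3] : Fin 4 → Fin 4) k) ↔ pat4 i j = pat4 i k) then cell w a b c y 2 else 0) +
      (if (∀ j k : Fin 4, pat4 3 ((![0, 2, 1, 3] : Fin 4 → Fin 4) j) = pat4 3 ((![0, 2, 1, 3] : Fin 4 → Fin 4) k) ↔ pat4 i j = pat4 i k) then cell w a b c y 3 else 0) +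
      (if (∀ j k : Fin 4, pat4 4 ((![0, 2, 1, 3] : Fin 4 → Fin 4) j) = pat4 4 ((![0, 2, 1, 3] : Fin 4 → Fin 4) k) ↔ pat4 i j = pat4 i k) then cell w a b c y 4 else 0) +
      (if (∀ j k : Fin 4, pat4 5 ((![0, 2, 1, 3] : Fin 4 → Fin 4) j) = pat4 5 ((![0, 2, 1, 3] : Fin 4 → Fin 4) k) ↔ pat4 i j = pat4 i k) then cell w a b c y 5 else 0) +
      (if (∀ j k : Fin 4, pat4 6 ((![0, 2, 1, 3] : Fin 4 → Fin 4) j) = pat4 6 ((![0, 2, 1, 3] : Fin 4 → Fin 4) k) ↔ pat4 i j = pat4 i k) then cell w a b c y 6 else 0) +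
      (if (∀ j k : Fin 4, pat4 7 ((![0, 2, 1, 3] : Fin 4 → Fin 4) j) = pat4 7 ((![0, 2, 1, 3] : Fin 4 → Fin 4) k) ↔ pat4 i j = pat4 i k) then cell w a b c y 7 else 0) +
      (if (∀ j k : Fin 4, pat4 8 ((![0, 2, 1, 3] : Fin 4 → Fin 4) j) = pat4 8 ((![0, 2, 1, 3] : Fin 4 → Fin 4) k) ↔ pat4 i j = pat4 i k) then cell w a b c y 8 else 0) +
      (if (∀ j k : Fin 4, pat4 9 ((![0, 2, 1, 3] : Fin 4 → Fin 4) j) = pat4 9 ((![0, 2, 1, 3] : Fin 4 → Fin 4) k) ↔ pat4 i j = pat4 i k) then cell w a b c y 9 else 0) +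
      (if (∀ j k : Fin 4, pat4 10 ((![0, 2, 1, 3] : Fin 4 → Fin 4) j) = pat4 10 ((![0, 2, 1, 3] : Fin 4 → Fin 4) k) ↔ pat4 i j = pat4 i k) then cell w a b c y 10 else 0) +
      (if (∀ j k : Fin 4, pat4 11 ((![0, 2, 1, 3] : Fin 4 → Fin 4) j) = pat4 11 ((![0, 2, 1, 3] : Fin 4 → Fin 4) k) ↔ pat4 i j = pat4 i k) then cell w a b c y 11 else 0) +
      (if (∀ j k : Fin 4, pat4 12 ((![0, 2, 1, 3] : Fin 4 → Fin 4) j) = pat4 12 ((![0, 2, 1, 3] : Fin 4 → Fin 4) k) ↔ pat4 i j = pat4 i k) then cell w a b c y 12 else 0) +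
      (if (∀ j k : Fin 4, pat4 13 ((![0, 2, 1, 3] : Fin 4 → Fin 4) j) = pat4 13 ((![0, 2, 1, 3] : Fin 4 → Fin 4) k) ↔ pat4 i j = pat4 i k) then cell w a b c y 13 else 0) +
      (if (∀ j k : Fin 4, pat4 14 ((![0, 2, 1, 3] : Fin 4 → Fin 4) j) = pat4 14 ((![0, 2, 1, 3] : Fin 4 → Fin 4) k) ↔ pat4 i j = pat4 i k) then cell w a b c y 14 else 0) := by
  unfold cell; rw [measureReal_eq_cellSum w a b c y (hasPattern_atom_perm (![0, 2, 1, 3] : Fin 4 → Fin 4) a b c y (q' := quad a c b y)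
    (by intro j; fin_cases j <;> rfl) (pat4 i))]; rfl

/-- Cells of the relabelled quadruple `(b a c y)` in the cells of `(a,b,c,y)`. [folklore] -/
theorem cell_relabel_bacy (w : Sym2 (Fin n) → unitInterval) (a b c y : Fin n) (i : Fin 15) :
    cell w b a c y i =
      (if (∀ j k : Fin 4, pat4 0 ((![1, 0, 2, 3] : Fin 4 → Fin 4) j) = pat4 0 ((![1, 0, 2, 3] : Fin 4 → Fin 4) k) ↔ pat4 i j = pat4 i k) then cell w a b c y 0 else 0) +
      (if (∀ j k : Fin 4, pat4 1 ((![1, 0, 2, 3] : Fin 4 → Fin 4) j) = pat4 1 ((![1, 0, 2, 3] : Fin 4 → Fin 4) k) ↔ pat4 i j = pat4 i k) then cell w a b c y 1 else 0) +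
      (if (∀ j k : Fin 4, pat4 2 ((![1, 0, 2, 3] : Fin 4 → Fin 4) j) = pat4 2 ((![1, 0, 2, 3] : Fin 4 → Fin 4) k) ↔ pat4 i j = pat4 i k) then cell w a b c y 2 else 0) +
      (if (∀ j k : Fin 4, pat4 3 ((![1, 0, 2, 3] : Fin 4 → Fin 4) j) = pat4 3 ((![1, 0, 2, 3] : Fin 4 → Fin 4) k) ↔ pat4 i j = pat4 i k) then cell w a b c y 3 else 0) +
      (if (∀ j k : Fin 4, pat4 4 ((![1, 0, 2, 3] : Fin 4 → Fin 4) j) = pat4 4 ((![1, 0, 2, 3] : Fin 4 → Fin 4) k) ↔ pat4 i j = pat4 i k) then cell w a b c y 4 else 0) +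
      (if (∀ j k : Fin 4, pat4 5 ((![1, 0, 2, 3] : Fin 4 → Fin 4) j) = pat4 5 ((![1, 0, 2, 3] : Fin 4 → Fin 4) k) ↔ pat4 i j = pat4 i k) then cell w a b c y 5 else 0) +
      (if (∀ j k : Fin 4, pat4 6 ((![1, 0, 2, 3] : Fin 4 → Fin 4) j) = pat4 6 ((![1, 0, 2, 3] : Fin 4 → Fin 4) k) ↔ pat4 i j = pat4 i k) then cell w a b c y 6 else 0) +
      (if (∀ j k : Fin 4, pat4 7 ((![1, 0, 2, 3] : Fin 4 → Fin 4) j) = pat4 7 ((![1, 0, 2, 3] : Fin 4 → Fin 4) k) ↔ pat4 i j = pat4 i k) then cell w a b c y 7 else 0) +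
      (if (∀ j k : Fin 4, pat4 8 ((![1, 0, 2, 3] : Fin 4 → Fin 4) j) = pat4 8 ((![1, 0, 2, 3] : Fin 4 → Fin 4) k) ↔ pat4 i j = pat4 i k) then cell w a b c y 8 else 0) +
      (if (∀ j k : Fin 4, pat4 9 ((![1, 0, 2, 3] : Fin 4 → Fin 4) j) = pat4 9 ((![1, 0, 2, 3] : Fin 4 → Fin 4) k) ↔ pat4 i j = pat4 i k) then cell w a b c y 9 else 0) +
      (if (∀ j k : Fin 4, pat4 10 ((![1, 0, 2, 3] : Fin 4 → Fin 4) j) = pat4 10 ((![1, 0, 2, 3] : Fin 4 → Fin 4) k) ↔ pat4 i j = pat4 i k) then cell w a b c y 10 else 0) +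
      (if (∀ j k : Fin 4, pat4 11 ((![1, 0, 2, 3] : Fin 4 → Fin 4) j) = pat4 11 ((![1, 0, 2, 3] : Fin 4 → Fin 4) k) ↔ pat4 i j = pat4 i k) then cell w a b c y 11 else 0) +
      (if (∀ j k : Fin 4, pat4 12 ((![1, 0, 2, 3] : Fin 4 → Fin 4) j) = pat4 12 ((![1, 0, 2, 3] : Fin 4 → Fin 4) k) ↔ pat4 i j = pat4 i k) then cell w a b c y 12 else 0) +
      (if (∀ j k : Fin 4, pat4 13 ((![1, 0, 2, 3] : Fin 4 → Fin 4) j) = pat4 13 ((![1, 0, 2, 3] : Fin 4 → Fin 4) k) ↔ pat4 i j = pat4 i k) then cell w a b c y 13 else 0) +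
      (if (∀ j k : Fin 4, pat4 14 ((![1, 0, 2, 3] : Fin 4 → Fin 4) j) = pat4 14 ((![1, 0, 2, 3] : Fin 4 → Fin 4) k) ↔ pat4 i j = pat4 i k) then cell w a b c y 14 else 0) := by
  unfold cell; rw [measureReal_eq_cellSum w a b c y (hasPattern_atom_perm (![1, 0, 2, 3] : Fin 4 → Fin 4) a b c y (q' := quad b a c y)
    (by intro j; fin_cases j <;> rfl) (pat4 i))]; rfl

/-- Cells of the relabelled quadruple `(c a b y)` in the cells of `(a,b,c,y)`. [folklore] -/
theorem cell_relabel_caby (w : Sym2 (Fin n) → unitInterval) (a b c y : Fin n) (i : Fin 15) :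
    cell w c a b y i =
      (if (∀ j k : Fin 4, pat4 0 ((![2, 0, 1, 3] : Fin 4 → Fin 4) j) = pat4 0 ((![2, 0, 1, 3] : Fin 4 → Fin 4) k) ↔ pat4 i j = pat4 i k) then cell w a b c y 0 else 0) +
      (if (∀ j k : Fin 4, pat4 1 ((![2, 0, 1, 3] : Fin 4 → Fin 4) j) = pat4 1 ((![2, 0, 1, 3] : Fin 4 → Fin 4) k) ↔ pat4 i j = pat4 i k) then cell w a b c y 1 else 0) +
      (if (∀ j k : Fin 4, pat4 2 ((![2, 0, 1, 3] : Fin 4 → Fin 4) j) = pat4 2 ((![2, 0, 1, 3] : Fin 4 → Fin 4) k) ↔ pat4 i j = pat4 i k) then cell w a b c y 2 else 0) +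
      (if (∀ j k : Fin 4, pat4 3 ((![2, 0, 1, 3] : Fin 4 → Fin 4) j) = pat4 3 ((![2, 0, 1, 3] : Fin 4 → Fin 4) k) ↔ pat4 i j = pat4 i k) then cell w a b c y 3 else 0) +
      (if (∀ j k : Fin 4, pat4 4 ((![2, 0, 1, 3] : Fin 4 → Fin 4) j) = pat4 4 ((![2, 0, 1, 3] : Fin 4 → Fin 4) k) ↔ pat4 i j = pat4 i k) then cell w a b c y 4 else 0) +
      (if (∀ j k : Fin 4, pat4 5 ((![2, 0, 1, 3] : Fin 4 → Fin 4) j) = pat4 5 ((![2, 0, 1, 3] : Fin 4 → Fin 4) k) ↔ pat4 i j = pat4 i k) then cell w a b c y 5 else 0) +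
      (if (∀ j k : Fin 4, pat4 6 ((![2, 0, 1, 3] : Fin 4 → Fin 4) j) = pat4 6 ((![2, 0, 1, 3] : Fin 4 → Fin 4) k) ↔ pat4 i j = pat4 i k) then cell w a b c y 6 else 0) +
      (if (∀ j k : Fin 4, pat4 7 ((![2, 0, 1, 3] : Fin 4 → Fin 4) j) = pat4 7 ((![2, 0, 1, 3] : Fin 4 → Fin 4) k) ↔ pat4 i j = pat4 i k) then cell w a b c y 7 else 0) +
      (if (∀ j k : Fin 4, pat4 8 ((![2, 0, 1, 3] : Fin 4 → Fin 4) j) = pat4 8 ((![2, 0, 1, 3] : Fin 4 → Fin 4) k) ↔ pat4 i j = pat4 i k) then cell w a b c y 8 else 0) +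
      (if (∀ j k : Fin 4, pat4 9 ((![2, 0, 1, 3] : Fin 4 → Fin 4) j) = pat4 9 ((![2, 0, 1, 3] : Fin 4 → Fin 4) k) ↔ pat4 i j = pat4 i k) then cell w a b c y 9 else 0) +
      (if (∀ j k : Fin 4, pat4 10 ((![2, 0, 1, 3] : Fin 4 → Fin 4) j) = pat4 10 ((![2, 0, 1, 3] : Fin 4 → Fin 4) k) ↔ pat4 i j = pat4 i k) then cell w a b c y 10 else 0) +
      (if (∀ j k : Fin 4, pat4 11 ((![2, 0, 1, 3] : Fin 4 → Fin 4) j) = pat4 11 ((![2, 0, 1, 3] : Fin 4 → Fin 4) k) ↔ pat4 i j = pat4 i k) then cell w a b c y 11 else 0) +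
      (if (∀ j k : Fin 4, pat4 12 ((![2, 0, 1, 3] : Fin 4 → Fin 4) j) = pat4 12 ((![2, 0, 1, 3] : Fin 4 → Fin 4) k) ↔ pat4 i j = pat4 i k) then cell w a b c y 12 else 0) +
      (if (∀ j k : Fin 4, pat4 13 ((![2, 0, 1, 3] : Fin 4 → Fin 4) j) = pat4 13 ((![2, 0, 1, 3] : Fin 4 → Fin 4) k) ↔ pat4 i j = pat4 i k) then cell w a b c y 13 else 0) +
      (if (∀ j k : Fin 4, pat4 14 ((![2, 0, 1, 3] : Fin 4 → Fin 4) j) = pat4 14 ((![2, 0, 1, 3] : Fin 4 → Fin 4) k) ↔ pat4 i j = pat4 i k) then cell w a b c y 14 else 0) := by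
  unfold cell; rw [measureReal_eq_cellSum w a b c y (hasPattern_atom_perm (![2, 0, 1, 3] : Fin 4 → Fin 4) a b c y (q' := quad c a b y)
    (by intro j; fin_cases j <;> rfl) (pat4 i))]; rfl

/-- Cells of the relabelled quadruple `(y c a b)` in the cells of `(a,b,c,y)`. [folklore] -/
theorem cell_relabel_ycab (w : Sym2 (Fin n) → unitInterval) (a b c y : Fin n) (i : Fin 15) :
    cell w y c a b i =
      (if (∀ j k : Fin 4, pat4 0 ((![3, 2, 0, 1] : Fin 4 → Fin 4) j) = pat4 0 ((![3, 2, 0, 1] : Fin 4 → Fin 4) k) ↔ pat4 i j = pat4 i k) then cell w a b c y 0 else 0) +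
      (if (∀ j k : Fin 4, pat4 1 ((![3, 2, 0, 1] : Fin 4 → Fin 4) j) = pat4 1 ((![3, 2, 0, 1] : Fin 4 → Fin 4) k) ↔ pat4 i j = pat4 i k) then cell w a b c y 1 else 0) +
      (if (∀ j k : Fin 4, pat4 2 ((![3, 2, 0, 1] : Fin 4 → Fin 4) j) = pat4 2 ((![3, 2, 0, 1] : Fin 4 → Fin 4) k) ↔ pat4 i j = pat4 i k) then cell w a b c y 2 else 0) +
      (if (∀ j k : Fin 4, pat4 3 ((![3, 2, 0, 1] : Fin 4 → Fin 4) j) = pat4 3 ((![3, 2, 0, 1] : Fin 4 → Fin 4) k) ↔ pat4 i j = pat4 i k) then cell w a b c y 3 else 0) +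
      (if (∀ j k : Fin 4, pat4 4 ((![3, 2, 0, 1] : Fin 4 → Fin 4) j) = pat4 4 ((![3, 2, 0, 1] : Fin 4 → Fin 4) k) ↔ pat4 i j = pat4 i k) then cell w a b c y 4 else 0) +
      (if (∀ j k : Fin 4, pat4 5 ((![3, 2, 0, 1] : Fin 4 → Fin 4) j) = pat4 5 ((![3, 2, 0, 1] : Fin 4 → Fin 4) k) ↔ pat4 i j = pat4 i k) then cell w a b c y 5 else 0) +
      (if (∀ j k : Fin 4, pat4 6 ((![3, 2, 0, 1] : Fin 4 → Fin 4) j) = pat4 6 ((![3, 2, 0, 1] : Fin 4 → Fin 4) k) ↔ pat4 i j = pat4 i k) then cell w a b c y 6 else 0) +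
      (if (∀ j k : Fin 4, pat4 7 ((![3, 2, 0, 1] : Fin 4 → Fin 4) j) = pat4 7 ((![3, 2, 0, 1] : Fin 4 → Fin 4) k) ↔ pat4 i j = pat4 i k) then cell w a b c y 7 else 0) +
      (if (∀ j k : Fin 4, pat4 8 ((![3, 2, 0, 1] : Fin 4 → Fin 4) j) = pat4 8 ((![3, 2, 0, 1] : Fin 4 → Fin 4) k) ↔ pat4 i j = pat4 i k) then cell w a b c y 8 else 0) +
      (if (∀ j k : Fin 4, pat4 9 ((![3, 2, 0, 1] : Fin 4 → Fin 4) j) = pat4 9 ((![3, 2, 0, 1] : Fin 4 → Fin 4) k) ↔ pat4 i j = pat4 i k) then cell w a b c y 9 else 0) +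
      (if (∀ j k : Fin 4, pat4 10 ((![3, 2, 0, 1] : Fin 4 → Fin 4) j) = pat4 10 ((![3, 2, 0, 1] : Fin 4 → Fin 4) k) ↔ pat4 i j = pat4 i k) then cell w a b c y 10 else 0) +
      (if (∀ j k : Fin 4, pat4 11 ((![3, 2, 0, 1] : Fin 4 → Fin 4) j) = pat4 11 ((![3, 2, 0, 1] : Fin 4 → Fin 4) k) ↔ pat4 i j = pat4 i k) then cell w a b c y 11 else 0) +
      (if (∀ j k : Fin 4, pat4 12 ((![3, 2, 0, 1] : Fin 4 → Fin 4) j) = pat4 12 ((![3, 2, 0, 1] : Fin 4 → Fin 4) k) ↔ pat4 i j = pat4 i k) then cell w a b c y 12 else 0) +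
      (if (∀ j k : Fin 4, pat4 13 ((![3, 2, 0, 1] : Fin 4 → Fin 4) j) = pat4 13 ((![3, 2, 0, 1] : Fin 4 → Fin 4) k) ↔ pat4 i j = pat4 i k) then cell w a b c y 13 else 0) +
      (if (∀ j k : Fin 4, pat4 14 ((![3, 2, 0, 1] : Fin 4 → Fin 4) j) = pat4 14 ((![3, 2, 0, 1] : Fin 4 → Fin 4) k) ↔ pat4 i j = pat4 i k) then cell w a b c y 14 else 0) := by
  unfold cell; rw [measureReal_eq_cellSum w a b c y (hasPattern_atom_perm (![3, 2, 0, 1] : Fin 4 → Fin 4) a b c y (q' := quad y c a b)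
    (by intro j; fin_cases j <;> rfl) (pat4 i))]; rfl

/-- Cells of the relabelled quadruple `(b a y c)` in the cells of `(a,b,c,y)`. [folklore] -/
theorem cell_relabel_bayc (w : Sym2 (Fin n) → unitInterval) (a b c y : Fin n) (i : Fin 15) :
    cell w b a y c i =
      (if (∀ j k : Fin 4, pat4 0 ((![1, 0, 3, 2] : Fin 4 → Fin 4) j) = pat4 0 ((![1, 0, 3, 2] : Fin 4 → Fin 4) k) ↔ pat4 i j = pat4 i k) then cell w a b c y 0 else 0) +
      (if (∀ j k : Fin 4, pat4 1 ((![1, 0, 3, 2] : Fin 4 → Fin 4) j) = pat4 1 ((![1, 0, 3, 2] : Fin 4 → Fin 4) k) ↔ pat4 i j = pat4 i k) then cell w a b c y 1 else 0) +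
      (if (∀ j k : Fin 4, pat4 2 ((![1, 0, 3, 2] : Fin 4 → Fin 4) j) = pat4 2 ((![1, 0, 3, 2] : Fin 4 → Fin 4) k) ↔ pat4 i j = pat4 i k) then cell w a b c y 2 else 0) +
      (if (∀ j k : Fin 4, pat4 3 ((![1, 0, 3, 2] : Fin 4 → Fin 4) j) = pat4 3 ((![1, 0, 3, 2] : Fin 4 → Fin 4) k) ↔ pat4 i j = pat4 i k) then cell w a b c y 3 else 0) +
      (if (∀ j k : Fin 4, pat4 4 ((![1, 0, 3, 2] : Fin 4 → Fin 4) j) = pat4 4 ((![1, 0, 3, 2] : Fin 4 → Fin 4) k) ↔ pat4 i j = pat4 i k) then cell w a b c y 4 else 0) +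
      (if (∀ j k : Fin 4, pat4 5 ((![1, 0, 3, 2] : Fin 4 → Fin 4) j) = pat4 5 ((![1, 0, 3, 2] : Fin 4 → Fin 4) k) ↔ pat4 i j = pat4 i k) then cell w a b c y 5 else 0) +
      (if (∀ j k : Fin 4, pat4 6 ((![1, 0, 3, 2] : Fin 4 → Fin 4) j) = pat4 6 ((![1, 0, 3, 2] : Fin 4 → Fin 4) k) ↔ pat4 i j = pat4 i k) then cell w a b c y 6 else 0) +
      (if (∀ j k : Fin 4, pat4 7 ((![1, 0, 3, 2] : Fin 4 → Fin 4) j) = pat4 7 ((![1, 0, 3, 2] : Fin 4 → Fin 4) k) ↔ pat4 i j = pat4 i k) then cell w a b c y 7 else 0) +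
      (if (∀ j k : Fin 4, pat4 8 ((![1, 0, 3, 2] : Fin 4 → Fin 4) j) = pat4 8 ((![1, 0, 3, 2] : Fin 4 → Fin 4) k) ↔ pat4 i j = pat4 i k) then cell w a b c y 8 else 0) +
      (if (∀ j k : Fin 4, pat4 9 ((![1, 0, 3, 2] : Fin 4 → Fin 4) j) = pat4 9 ((![1, 0, 3, 2] : Fin 4 → Fin 4) k) ↔ pat4 i j = pat4 i k) then cell w a b c y 9 else 0) +
      (if (∀ j k : Fin 4, pat4 10 ((![1, 0, 3, 2] : Fin 4 → Fin 4) j) = pat4 10 ((![1, 0, 3, 2] : Fin 4 → Fin 4) k) ↔ pat4 i j = pat4 i k) then cell w a b c y 10 else 0) +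
      (if (∀ j k : Fin 4, pat4 11 ((![1, 0, 3, 2] : Fin 4 → Fin 4) j) = pat4 11 ((![1, 0, 3, 2] : Fin 4 → Fin 4) k) ↔ pat4 i j = pat4 i k) then cell w a b c y 11 else 0) +
      (if (∀ j k : Fin 4, pat4 12 ((![1, 0, 3, 2] : Fin 4 → Fin 4) j) = pat4 12 ((![1, 0, 3, 2] : Fin 4 → Fin 4) k) ↔ pat4 i j = pat4 i k) then cell w a b c y 12 else 0) +
      (if (∀ j k : Fin 4, pat4 13 ((![1, 0, 3, 2] : Fin 4 → Fin 4) j) = pat4 13 ((![1, 0, 3, 2] : Fin 4 → Fin 4) k) ↔ pat4 i j = pat4 i k) then cell w a b c y 13 else 0) +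
      (if (∀ j k : Fin 4, pat4 14 ((![1, 0, 3, 2] : Fin 4 → Fin 4) j) = pat4 14 ((![1, 0, 3, 2] : Fin 4 → Fin 4) k) ↔ pat4 i j = pat4 i k) then cell w a b c y 14 else 0) := by
  unfold cell; rw [measureReal_eq_cellSum w a b c y (hasPattern_atom_perm (![1, 0, 3, 2] : Fin 4 → Fin 4) a b c y (q' := quad b a y c)
    (by intro j; fin_cases j <;> rfl) (pat4 i))]; rfl

/-- Cells of the relabelled quadruple `(y c b a)` in the cells of `(a,b,c,y)`. [folklore] -/
theorem cell_relabel_ycba (w : Sym2 (Fin n) → unitInterval) (a b c y : Fin n) (i : Fin 15) :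
    cell w y c b a i =
      (if (∀ j k : Fin 4, pat4 0 ((![3, 2, 1, 0] : Fin 4 → Fin 4) j) = pat4 0 ((![3, 2, 1, 0] : Fin 4 → Fin 4) k) ↔ pat4 i j = pat4 i k) then cell w a b c y 0 else 0) +
      (if (∀ j k : Fin 4, pat4 1 ((![3, 2, 1, 0] : Fin 4 → Fin 4) j) = pat4 1 ((![3, 2, 1, 0] : Fin 4 → Fin 4) k) ↔ pat4 i j = pat4 i k) then cell w a b c y 1 else 0) +
      (if (∀ j k : Fin 4, pat4 2 ((![3, 2, 1, 0] : Fin 4 → Fin 4) j) = pat4 2 ((![3, 2, 1, 0] : Fin 4 → Fin 4) k) ↔ pat4 i j = pat4 i k) then cell w a b c y 2 else 0) +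
      (if (∀ j k : Fin 4, pat4 3 ((![3, 2, 1, 0] : Fin 4 → Fin 4) j) = pat4 3 ((![3, 2, 1, 0] : Fin 4 → Fin 4) k) ↔ pat4 i j = pat4 i k) then cell w a b c y 3 else 0) +
      (if (∀ j k : Fin 4, pat4 4 ((![3, 2, 1, 0] : Fin 4 → Fin 4) j) = pat4 4 ((![3, 2, 1, 0] : Fin 4 → Fin 4) k) ↔ pat4 i j = pat4 i k) then cell w a b c y 4 else 0) +
      (if (∀ j k : Fin 4, pat4 5 ((![3, 2, 1, 0] : Fin 4 → Fin 4) j) = pat4 5 ((![3, 2, 1, 0] : Fin 4 → Fin 4) k) ↔ pat4 i j = pat4 i k) then cell w a b c y 5 else 0) +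
      (if (∀ j k : Fin 4, pat4 6 ((![3, 2, 1, 0] : Fin 4 → Fin 4) j) = pat4 6 ((![3, 2, 1, 0] : Fin 4 → Fin 4) k) ↔ pat4 i j = pat4 i k) then cell w a b c y 6 else 0) +
      (if (∀ j k : Fin 4, pat4 7 ((![3, 2, 1, 0] : Fin 4 → Fin 4) j) = pat4 7 ((![3, 2, 1, 0] : Fin 4 → Fin 4) k) ↔ pat4 i j = pat4 i k) then cell w a b c y 7 else 0) +
      (if (∀ j k : Fin 4, pat4 8 ((![3, 2, 1, 0] : Fin 4 → Fin 4) j) = pat4 8 ((![3, 2, 1, 0] : Fin 4 → Fin 4) k) ↔ pat4 i j = pat4 i k) then cell w a b c y 8 else 0) +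
      (if (∀ j k : Fin 4, pat4 9 ((![3, 2, 1, 0] : Fin 4 → Fin 4) j) = pat4 9 ((![3, 2, 1, 0] : Fin 4 → Fin 4) k) ↔ pat4 i j = pat4 i k) then cell w a b c y 9 else 0) +
      (if (∀ j k : Fin 4, pat4 10 ((![3, 2, 1, 0] : Fin 4 → Fin 4) j) = pat4 10 ((![3, 2, 1, 0] : Fin 4 → Fin 4) k) ↔ pat4 i j = pat4 i k) then cell w a b c y 10 else 0) +
      (if (∀ j k : Fin 4, pat4 11 ((![3, 2, 1, 0] : Fin 4 → Fin 4) j) = pat4 11 ((![3, 2, 1, 0] : Fin 4 → Fin 4) k) ↔ pat4 i j = pat4 i k) then cell w a b c y 11 else 0) +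
      (if (∀ j k : Fin 4, pat4 12 ((![3, 2, 1, 0] : Fin 4 → Fin 4) j) = pat4 12 ((![3, 2, 1, 0] : Fin 4 → Fin 4) k) ↔ pat4 i j = pat4 i k) then cell w a b c y 12 else 0) +
      (if (∀ j k : Fin 4, pat4 13 ((![3, 2, 1, 0] : Fin 4 → Fin 4) j) = pat4 13 ((![3, 2, 1, 0] : Fin 4 → Fin 4) k) ↔ pat4 i j = pat4 i k) then cell w a b c y 13 else 0) +
      (if (∀ j k : Fin 4, pat4 14 ((![3, 2, 1, 0] : Fin 4 → Fin 4) j) = pat4 14 ((![3, 2, 1, 0] : Fin 4 → Fin 4) k) ↔ pat4 i j = pat4 i k) then cell w a b c y 14 else 0) := by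
  unfold cell; rw [measureReal_eq_cellSum w a b c y (hasPattern_atom_perm (![3, 2, 1, 0] : Fin 4 → Fin 4) a b c y (q' := quad y c b a)
    (by intro j; fin_cases j <;> rfl) (pat4 i))]; rfl


/-! ## Three exchange rows -/

section exchangeRows
variable (w : Sym2 (Fin n) → unitInterval) (a b c y : Fin n)

/-- `{{s,s'} ↮ {t,t'}}` as an intersection of complements. [folklore] -/
theorem Dis_two_two_eq (s s' t t' : Fin n) :
    {ω : BondConfig (Fin n) | ∀ u ∈ ({s, s'} : Set (Fin n)), ∀ v ∈ ({t, t'} : Set (Fin n)), ¬ (openGraph ω).Reachable u v} =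
      ((openConn s t)ᶜ ∩ (openConn s t')ᶜ) ∩ ((openConn s' t)ᶜ ∩ (openConn s' t')ᶜ) := by
  ext ω
  simp only [Set.mem_setOf_eq, Set.mem_insert_iff, Set.mem_singleton_iff, forall_eq_or_imp, forall_eq,
    Set.mem_inter_iff, Set.mem_compl_iff, openConn]

/-- `{s ↮ t,u}` as an intersection of complements. [folklore] -/
theorem Dis_one_two_eq (s t u : Fin n) :
    {ω : BondConfig (Fin n) | ∀ s' ∈ ({s} : Set (Fin n)), ∀ t' ∈ ({t, u} : Set (Fin n)), ¬ (openGraph ω).Reachable s' t'} =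
      (openConn s t)ᶜ ∩ (openConn s u)ᶜ := by
  ext ω
  simp only [Set.mem_setOf_eq, Set.mem_insert_iff, Set.mem_singleton_iff, forall_eq_or_imp, forall_eq,
    Set.mem_inter_iff, Set.mem_compl_iff, openConn]

/-- `μ({a,c}↮{b,y}) = cell 0 + cell 2 + cell 5 + cell 9`. [this work] -/
theorem realA_D : (prodBernoulli w).real (((openConn a b)ᶜ ∩ (openConn a y)ᶜ) ∩ ((openConn c b)ᶜ ∩ (openConn c y)ᶜ)) =
    cell w a b c y 0 + cell w a b c y 2 + cell w a b c y 5 + cell w a b c y 9 := by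
  rw [measureReal_eq_cellSum w a b c y (show HasPattern (quad a b c y)
      (((openConn a b)ᶜ ∩ (openConn a y)ᶜ) ∩ ((openConn c b)ᶜ ∩ (openConn c y)ᶜ)) _ from
    (((oc a b c y 0 1 rfl rfl).compl.inter (oc a b c y 0 3 rfl rfl).compl).inter
      ((oc a b c y 2 1 rfl rfl).compl.inter (oc a b c y 2 3 rfl rfl).compl)))]
  simp (config := {decide := true}) only [ite_true, ite_false]; ring

/-- `μ({a,c}↮{b,y} ∩ ({a↔c} ∩ {b↔y})) = cell 9`. [this work] -/
theorem realA_DFG : (prodBernoulli w).real ((((openConn a b)ᶜ ∩ (openConn a y)ᶜ) ∩ ((openConn c b)ᶜ ∩ (openConn c y)ᶜ)) ∩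
      (openConn a c ∩ openConn b y)) = cell w a b c y 9 := by
  rw [measureReal_eq_cellSum w a b c y (show HasPattern (quad a b c y)
      ((((openConn a b)ᶜ ∩ (openConn a y)ᶜ) ∩ ((openConn c b)ᶜ ∩ (openConn c y)ᶜ)) ∩ (openConn a c ∩ openConn b y)) _ from
    ((((oc a b c y 0 1 rfl rfl).compl.inter (oc a b c y 0 3 rfl rfl).compl).inter
      ((oc a b c y 2 1 rfl rfl).compl.inter (oc a b c y 2 3 rfl rfl).compl)).inter
      ((oc a b c y 0 2 rfl rfl).inter (oc a b c y 1 3 rfl rfl))))]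
  simp (config := {decide := true}) only [ite_true, ite_false]; ring

/-- `μ({a,c}↮{b,y} ∩ {a↔c}) = cell 5 + cell 9`. [this work] -/
theorem realA_DF : (prodBernoulli w).real ((((openConn a b)ᶜ ∩ (openConn a y)ᶜ) ∩ ((openConn c b)ᶜ ∩ (openConn c y)ᶜ)) ∩
      openConn a c) = cell w a b c y 5 + cell w a b c y 9 := by
  rw [measureReal_eq_cellSum w a b c y (show HasPattern (quad a b c y)
      ((((openConn a b)ᶜ ∩ (openConn a y)ᶜ) ∩ ((openConn c b)ᶜ ∩ (openConn c y)ᶜ)) ∩ openConn a c) _ from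
    ((((oc a b c y 0 1 rfl rfl).compl.inter (oc a b c y 0 3 rfl rfl).compl).inter
      ((oc a b c y 2 1 rfl rfl).compl.inter (oc a b c y 2 3 rfl rfl).compl)).inter (oc a b c y 0 2 rfl rfl)))]
  simp (config := {decide := true}) only [ite_true, ite_false]; ring

/-- `μ({a,c}↮{b,y} ∩ {b↔y}) = cell 2 + cell 9`. [this work] -/
theorem realA_DG : (prodBernoulli w).real ((((openConn a b)ᶜ ∩ (openConn a y)ᶜ) ∩ ((openConn c b)ᶜ ∩ (openConn c y)ᶜ)) ∩
      openConn b y) = cell w a b c y 2 + cell w a b c y 9 := by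
  rw [measureReal_eq_cellSum w a b c y (show HasPattern (quad a b c y)
      ((((openConn a b)ᶜ ∩ (openConn a y)ᶜ) ∩ ((openConn c b)ᶜ ∩ (openConn c y)ᶜ)) ∩ openConn b y) _ from
    ((((oc a b c y 0 1 rfl rfl).compl.inter (oc a b c y 0 3 rfl rfl).compl).inter
      ((oc a b c y 2 1 rfl rfl).compl.inter (oc a b c y 2 3 rfl rfl).compl)).inter (oc a b c y 1 3 rfl rfl)))]
  simp (config := {decide := true}) only [ite_true, ite_false]; ring

/-- **Exchange row A′**: `μ(a|b|c|y)·μ(ac|by) ≤ μ(a|by|c)·μ(ac|b|y)` (`cell 0 · cell 9 ≤ cell 2 · cell 5`): given `{a,c} ↮ {b,y}` the events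
`{a ↔ c}` and `{b ↔ y}` are negatively correlated — the two-set exchange with `S = {a,c}`, `T = {b,y}`. [this work] -/
theorem exch_c0c9_le_c2c5 : cell w a b c y 0 * cell w a b c y 9 ≤ cell w a b c y 2 * cell w a b c y 5 := by
  have ha : a ∈ ({a, c} : Set (Fin n)) := by simp
  have hb : b ∈ ({b, y} : Set (Fin n)) := by simp
  have key := setTwoClusterExchange w ({a, c} : Set (Fin n)) ({b, y} : Set (Fin n))
    (A₁ := (openConn a c : Set (BondConfig (Fin n)))) (A₂ := (Set.univ : Set (BondConfig (Fin n))))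
    (B₁ := (openConn b y : Set (BondConfig (Fin n)))) (B₂ := (Set.univ : Set (BondConfig (Fin n))))
    (TwoSetExchange.typePlus_openConn_of_mem _ _ ha c) (fun _ _ _ _ _ => Set.mem_univ _)
    (TwoSetExchange.typeMinus_openConn_of_mem _ _ hb y) (fun _ _ _ _ _ => Set.mem_univ _)
  simp only [Set.inter_univ, Dis_two_two_eq] at key
  rw [realA_DFG, realA_D, realA_DF, realA_DG] at key
  nlinarith [key, cell_nonneg w a b c y 0, cell_nonneg w a b c y 2, cell_nonneg w a b c y 5, cell_nonneg w a b c y 9]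

/-- `μ({a↮b,c} ∩ (({b↮c} ∩ {b↮y}) ∩ {c↔y})) = cell 1`. [this work] -/
theorem realD1_L₁ : (prodBernoulli w).real (((openConn a b)ᶜ ∩ (openConn a c)ᶜ) ∩
      (((openConn b c)ᶜ ∩ (openConn b y)ᶜ) ∩ openConn c y)) = cell w a b c y 1 := by
  rw [measureReal_eq_cellSum w a b c y (show HasPattern (quad a b c y) (((openConn a b)ᶜ ∩ (openConn a c)ᶜ) ∩
      (((openConn b c)ᶜ ∩ (openConn b y)ᶜ) ∩ openConn c y)) _ from
    (((oc a b c y 0 1 rfl rfl).compl.inter (oc a b c y 0 2 rfl rfl).compl).inter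
      ((((oc a b c y 1 2 rfl rfl).compl.inter (oc a b c y 1 3 rfl rfl).compl)).inter (oc a b c y 2 3 rfl rfl))))]
  simp (config := {decide := true}) only [ite_true, ite_false]; ring

/-- `μ({a↮b,c} ∩ ({a↔y} ∩ {b↔c})) = cell 8`. [this work] -/
theorem realD1_L₂ : (prodBernoulli w).real (((openConn a b)ᶜ ∩ (openConn a c)ᶜ) ∩ (openConn a y ∩ openConn b c)) =
    cell w a b c y 8 := by
  rw [measureReal_eq_cellSum w a b c y (show HasPattern (quad a b c y) (((openConn a b)ᶜ ∩ (openConn a c)ᶜ) ∩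
      (openConn a y ∩ openConn b c)) _ from
    (((oc a b c y 0 1 rfl rfl).compl.inter (oc a b c y 0 2 rfl rfl).compl).inter
      ((oc a b c y 0 3 rfl rfl).inter (oc a b c y 1 2 rfl rfl))))]
  simp (config := {decide := true}) only [ite_true, ite_false]; ring

/-- `μ({a↮b,c} ∩ (({b↮c} ∩ {b↮y}) ∩ {a↔y})) = cell 4`. [this work] -/
theorem realD1_R₁ : (prodBernoulli w).real (((openConn a b)ᶜ ∩ (openConn a c)ᶜ) ∩
      (((openConn b c)ᶜ ∩ (openConn b y)ᶜ) ∩ openConn a y)) = cell w a b c y 4 := by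
  rw [measureReal_eq_cellSum w a b c y (show HasPattern (quad a b c y) (((openConn a b)ᶜ ∩ (openConn a c)ᶜ) ∩
      (((openConn b c)ᶜ ∩ (openConn b y)ᶜ) ∩ openConn a y)) _ from
    (((oc a b c y 0 1 rfl rfl).compl.inter (oc a b c y 0 2 rfl rfl).compl).inter
      ((((oc a b c y 1 2 rfl rfl).compl.inter (oc a b c y 1 3 rfl rfl).compl)).inter (oc a b c y 0 3 rfl rfl))))]
  simp (config := {decide := true}) only [ite_true, ite_false]; ring

/-- `μ({a↮b,c} ∩ ({c↔y} ∩ {b↔c})) = cell 7`. [this work] -/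
theorem realD1_R₂ : (prodBernoulli w).real (((openConn a b)ᶜ ∩ (openConn a c)ᶜ) ∩ (openConn c y ∩ openConn b c)) =
    cell w a b c y 7 := by
  rw [measureReal_eq_cellSum w a b c y (show HasPattern (quad a b c y) (((openConn a b)ᶜ ∩ (openConn a c)ᶜ) ∩
      (openConn c y ∩ openConn b c)) _ from
    (((oc a b c y 0 1 rfl rfl).compl.inter (oc a b c y 0 2 rfl rfl).compl).inter
      ((oc a b c y 2 3 rfl rfl).inter (oc a b c y 1 2 rfl rfl))))]
  simp (config := {decide := true}) only [ite_true, ite_false]; ring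

/-- **Type-D exchange row D′**: `μ(a|b|cy)·μ(ay|bc) ≤ μ(ay|b|c)·μ(a|bcy)` (`cell 1 · cell 8 ≤ cell 4 · cell 7`) — the two-set exchange with
`S = {a}`, `T = {b,c}`, `A₁ = {b↮c} ∩ {b↮y}`, `B₁ = {c↔y}`, `A₂ = {a↔y}`, `B₂ = {b↔c}`. [this work] -/
theorem exch_c1c8_le_c4c7 : cell w a b c y 1 * cell w a b c y 8 ≤ cell w a b c y 4 * cell w a b c y 7 := by
  have ha : a ∈ ({a} : Set (Fin n)) := by simp
  have hb : b ∈ ({b, c} : Set (Fin n)) := by simp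
  have hc : c ∈ ({b, c} : Set (Fin n)) := by simp
  have key := setTwoClusterExchange w ({a} : Set (Fin n)) ({b, c} : Set (Fin n))
    (A₁ := ((openConn b c)ᶜ ∩ (openConn b y)ᶜ : Set (BondConfig (Fin n))))
    (A₂ := (openConn a y : Set (BondConfig (Fin n))))
    (B₁ := (openConn c y : Set (BondConfig (Fin n))))
    (B₂ := (openConn b c : Set (BondConfig (Fin n))))
    (fun _ _ hs ht hω => ⟨TwoSetExchange.typePlus_not_openConn_of_mem _ _ hb c hs ht hω.1,
      TwoSetExchange.typePlus_not_openConn_of_mem _ _ hb y hs ht hω.2⟩)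
    (TwoSetExchange.typePlus_openConn_of_mem _ _ ha y)
    (TwoSetExchange.typeMinus_openConn_of_mem _ _ hc y)
    (TwoSetExchange.typeMinus_openConn_of_mem _ _ hb c)
  rwa [Dis_one_two_eq, realD1_L₁, realD1_L₂, realD1_R₁, realD1_R₂] at key

/-- `μ({c↮a,y} ∩ ({a↮y} ∩ ({a↔b} ∩ {c↮b}))) = cell 6`. [this work] -/
theorem realD2_L₁ : (prodBernoulli w).real (((openConn c a)ᶜ ∩ (openConn c y)ᶜ) ∩
      ((openConn a y)ᶜ ∩ (openConn a b ∩ (openConn c b)ᶜ))) = cell w a b c y 6 := by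
  rw [measureReal_eq_cellSum w a b c y (show HasPattern (quad a b c y) (((openConn c a)ᶜ ∩ (openConn c y)ᶜ) ∩
      ((openConn a y)ᶜ ∩ (openConn a b ∩ (openConn c b)ᶜ))) _ from
    (((oc a b c y 2 0 rfl rfl).compl.inter (oc a b c y 2 3 rfl rfl).compl).inter
      ((oc a b c y 0 3 rfl rfl).compl.inter ((oc a b c y 0 1 rfl rfl).inter (oc a b c y 2 1 rfl rfl).compl))))]
  simp (config := {decide := true}) only [ite_true, ite_false]; ring

/-- `μ({c↮a,y} ∩ ({c↔b} ∩ {a↔y})) = cell 8`. [this work] -/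
theorem realD2_L₂ : (prodBernoulli w).real (((openConn c a)ᶜ ∩ (openConn c y)ᶜ) ∩ (openConn c b ∩ openConn a y)) =
    cell w a b c y 8 := by
  rw [measureReal_eq_cellSum w a b c y (show HasPattern (quad a b c y) (((openConn c a)ᶜ ∩ (openConn c y)ᶜ) ∩
      (openConn c b ∩ openConn a y)) _ from
    (((oc a b c y 2 0 rfl rfl).compl.inter (oc a b c y 2 3 rfl rfl).compl).inter
      ((oc a b c y 2 1 rfl rfl).inter (oc a b c y 0 3 rfl rfl))))]
  simp (config := {decide := true}) only [ite_true, ite_false]; ring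

/-- `μ({c↮a,y} ∩ ({a↮y} ∩ {c↔b})) = cell 3`. [this work] -/
theorem realD2_R₁ : (prodBernoulli w).real (((openConn c a)ᶜ ∩ (openConn c y)ᶜ) ∩ ((openConn a y)ᶜ ∩ openConn c b)) =
    cell w a b c y 3 := by
  rw [measureReal_eq_cellSum w a b c y (show HasPattern (quad a b c y) (((openConn c a)ᶜ ∩ (openConn c y)ᶜ) ∩
      ((openConn a y)ᶜ ∩ openConn c b)) _ from
    (((oc a b c y 2 0 rfl rfl).compl.inter (oc a b c y 2 3 rfl rfl).compl).inter
      ((oc a b c y 0 3 rfl rfl).compl.inter (oc a b c y 2 1 rfl rfl))))]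
  simp (config := {decide := true}) only [ite_true, ite_false]; ring

/-- `μ({c↮a,y} ∩ (({a↔b} ∩ {c↮b}) ∩ {a↔y})) = cell 12`. [this work] -/
theorem realD2_R₂ : (prodBernoulli w).real (((openConn c a)ᶜ ∩ (openConn c y)ᶜ) ∩
      ((openConn a b ∩ (openConn c b)ᶜ) ∩ openConn a y)) = cell w a b c y 12 := by
  rw [measureReal_eq_cellSum w a b c y (show HasPattern (quad a b c y) (((openConn c a)ᶜ ∩ (openConn c y)ᶜ) ∩
      ((openConn a b ∩ (openConn c b)ᶜ) ∩ openConn a y)) _ from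
    (((oc a b c y 2 0 rfl rfl).compl.inter (oc a b c y 2 3 rfl rfl).compl).inter
      (((oc a b c y 0 1 rfl rfl).inter (oc a b c y 2 1 rfl rfl).compl).inter (oc a b c y 0 3 rfl rfl))))]
  simp (config := {decide := true}) only [ite_true, ite_false]; ring

/-- **Type-D exchange row D″**: `μ(ab|c|y)·μ(ay|bc) ≤ μ(a|bc|y)·μ(aby|c)` (`cell 6 · cell 8 ≤ cell 3 · cell 12`) — the two-set exchange with
`S = {c}`, `T = {a,y}`, `A₁ = {a↮y}`, `B₁ = {a↔b} ∩ {c↮b}`, `A₂ = {c↔b}`, `B₂ = {a↔y}`. [this work] -/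
theorem exch_c6c8_le_c3c12 : cell w a b c y 6 * cell w a b c y 8 ≤ cell w a b c y 3 * cell w a b c y 12 := by
  have hc : c ∈ ({c} : Set (Fin n)) := by simp
  have ha : a ∈ ({a, y} : Set (Fin n)) := by simp
  have key := setTwoClusterExchange w ({c} : Set (Fin n)) ({a, y} : Set (Fin n))
    (A₁ := ((openConn a y)ᶜ : Set (BondConfig (Fin n))))
    (A₂ := (openConn c b : Set (BondConfig (Fin n))))
    (B₁ := (openConn a b ∩ (openConn c b)ᶜ : Set (BondConfig (Fin n))))
    (B₂ := (openConn a y : Set (BondConfig (Fin n))))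
    (TwoSetExchange.typePlus_not_openConn_of_mem _ _ ha y)
    (TwoSetExchange.typePlus_openConn_of_mem _ _ hc b)
    (fun _ _ hs ht hω => ⟨TwoSetExchange.typeMinus_openConn_of_mem _ _ ha b hs ht hω.1,
      TwoSetExchange.typeMinus_not_openConn_of_mem _ _ hc b hs ht hω.2⟩)
    (TwoSetExchange.typeMinus_openConn_of_mem _ _ ha y)
  rwa [Dis_one_two_eq, realD2_L₁, realD2_L₂, realD2_R₁, realD2_R₂] at key

end exchangeRows


end Q44TopGood

end Summit.CriticalPhenomena.PercolationContinuityZ3.Theorems
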